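import Summits.ResolutionOfSingularities.ResolutionOfSingularities.Theorems.FrobeniusClosingSteerDivisorTriggerTwo
import Literature.AlgebraicGeometry.Resolution.RegularLocalRingsUFD
import Literature.AlgebraicGeometry.Resolution.RegularLocalHeights
import Mathlib.RingTheory.Ideal.KrullsHeightTheorem
import Mathlib.RingTheory.UniqueFactorizationDomain.Ideal
import HarnessLib

/-!
# No singular carrier along a σ_top-steered run — part 1: the CARRIER DICHOTOMY at one stage
# ((N4) of res-L0-w41-plan-1 RULING 7 §σ2.20 «NORMALISED START», W4.1 crux `Steer`)

W4.1, crux `Steer` (stmt-ResolutionOfSingularities-16345), σ-residual at `p = 2`, §σ2.20 (res-L0-w41-plan-1 RULING 7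
2026-08-27T07:54:40Z; defs `NormalAt` / `NoSingularCarrier` typed by res-L0-w41-strat-2, `R2TwoSigma-s16-strat2.r24.delta.lean`
§σ2.20): «res-type-082: TAKE (N4) `noSingularCarrier_along_run : NormalAt O (R 0) p t → IsSteeredRun O R P t p s →
∀ i, NoSingularCarrier O (R i) p (s i)`». Theses-free, def-free: the bodies of the skeleton's `IsSingPrime` /
`IsTopSingComponent` / `IsPermissibleCentre` / `IsSigmaTopCentre` / `RadicandRing` (res-L0-w41-lead-1 `Steer_r24.lean`
§σ2.1) and of strat-2's `NormalAt` / `NoSingularCarrier` appear UNFOLDED as binders and conclusions.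

A CARRIER of the radicand `f = s ^ p ∈ R` at a member `R` of the run is a triple `(g, h, u) ∈ R³` with
`s ^ p = g ^ p + h ^ p · u`; `NoSingularCarrier` asks that every prime factor `q` of every carrier's `h` has `R ⧸ (q)`
regular; `NormalAt` that no carrier has `h` of positive value. This part proves, for ONE regular local member
`R ⊆ K` (`char K = p`, dimension `n ≥ 2`, dominated by `O`, generic torsor fibre a field):

* `isPermissibleCentre_of_prime_carrier` — **a REGULAR prime carrier is a σ_top-permissible centre**: if `q ∈ R` is
  prime with `R ⧸ (q)` regular and `f − G ^ p ∈ (q) ^ p`, then `(q)` satisfies the body of `IsPermissibleCentre R p f (q)`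
  (singular at `(q)` by res-type-082's `singular_atPrime_of_sub_pow_mem_sq`; minimal since `⊥` is not singular,
  res-D-pv-011's `isRegularLocalRing_adjoinRoot_bot`; top-dimensional by the dimension formula; the template is
  res-D-pv-011's `DivisorTrigger.exceptional_isPermissibleCentre`, whose `(x)` is the case `q = x`);
* `height_eq_one_of_sigmaTop_of_prime_carrier` — hence **σ_top takes a DIVISOR first**: if some regular prime
  carrier exists, the σ_top centre `P` is not the closed point and is a height-one prime `P = (π)`, `π` prime
  (top-dimensionality of `P` against the minimal singular prime `(q)`, and Auslander–Buchsbaum);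
* `normalAt_or_divisorCentre_of_noSingularCarrier` — **the carrier dichotomy**: under `NoSingularCarrier` at
  `(R, s)`, EITHER `NormalAt` holds at `(R, s)` OR the σ_top centre is a principal prime divisor `(π) ≠ 𝔪_R`.

Part 2 (`…NoSingularCarrierStep.lean`) propagates across one steered step (divisor steps are trivial and create no
new carrier; from a `NormalAt` stage no SINGULAR carrier survives the blow-up — the exceptional prime is regular,
every other height-one prime is birational to one of `R`, where a local Frobenius congruence is global by (N5));
part 3 assembles (N4) by induction. OURS (the W4.1 engine; hand-derived by res-L0-w41-plan-1 / tri-3, AI review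
weaker than expert review); nothing here is attributed to [claim: Hironaka2017]; standard commutative algebra.
[cite: Matsumura1987, Thm. 14.2, Thm. 20.3] [cite: NovacoskiSpivakovsky2014, Def. 2.11]
-/

noncomputable section

-- `Summit.<S>.<S>.…` duplicates the summit name by design (single-problem summit).
set_option linter.dupNamespace false

open Polynomial IsLocalRing Literature.AlgebraicGeometry.Resolution

namespace Summit.ResolutionOfSingularities.ResolutionOfSingularities.Theorems.SwitchingDichotomy.NoSingularCarrier

variable {K : Type} [Field K]

/-! ## §1 A regular prime carrier is a σ_top-permissible centre -/

/-- **A regular prime carrier `(q)` is a σ_top-PERMISSIBLE centre.** Let `R ⊆ K` be a regular local subring of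
dimension `n ≥ 2`, `char K = p`, `f = s ^ p ∈ R` with `s·z ∉ R` for `z ∈ R ∖ 0` (the generic torsor fibre is a field),
and `q ∈ R` a prime element with `R ⧸ (q)` regular and `f − G ^ p ∈ (q) ^ p` for some `G`. Then `(q)` satisfies the
body of the skeleton's `IsPermissibleCentre R p f (q)`: `(q) ≠ 𝔪_R`; `(q)` is a singular prime of `T ^ p = f`
(`f − G^p ∈ (q)²`), minimal among singular primes (`⊥` is not singular) and of top dimension `n − 1` among them
(dimension formula); `R ⧸ (q)` is regular; `f` is cleaned into `(q) ^ p`. OURS (W4.1 engine, RULING 7 (N4)).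
[cite: Matsumura1987, Thm. 14.2] -/
theorem isPermissibleCentre_of_prime_carrier (p : ℕ) [Fact p.Prime] [CharP K p] (R : Subring K)
    [IsRegularLocalRing R] {n : ℕ} (hdim : ringKrullDim R = n) (hn : 2 ≤ n)
    {s : K} (hs : s ^ p ∈ R) (hirr : ∀ y z : R, (z : K) ≠ 0 → s * z ≠ y)
    (q : R) (hq : Prime q) (hregq : IsRegularLocalRing (R ⧸ Ideal.span {q}))
    (hclean : ∃ G : R, (⟨s ^ p, hs⟩ : R) - G ^ p ∈ Ideal.span {q} ^ p) :
    Ideal.span {q} ≠ maximalIdeal R ∧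
      (∃ _ : (Ideal.span {q}).IsPrime,
        ¬ IsRegularLocalRing (AdjoinRoot (Polynomial.X ^ p - Polynomial.C
            (algebraMap R (Localization.AtPrime (Ideal.span {q})) ⟨s ^ p, hs⟩))) ∧
        (∀ (Q : Ideal R) [Q.IsPrime],
          ¬ IsRegularLocalRing (AdjoinRoot (Polynomial.X ^ p - Polynomial.C
              (algebraMap R (Localization.AtPrime Q) ⟨s ^ p, hs⟩))) →
            Q ≤ Ideal.span {q} → Q = Ideal.span {q}) ∧
        (∀ (Q : Ideal R) [Q.IsPrime],
          ¬ IsRegularLocalRing (AdjoinRoot (Polynomial.X ^ p - Polynomial.C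
              (algebraMap R (Localization.AtPrime Q) ⟨s ^ p, hs⟩))) →
            (∀ (Q' : Ideal R) [Q'.IsPrime],
              ¬ IsRegularLocalRing (AdjoinRoot (Polynomial.X ^ p - Polynomial.C
                  (algebraMap R (Localization.AtPrime Q') ⟨s ^ p, hs⟩))) →
                Q' ≤ Q → Q' = Q) →
            ringKrullDim (R ⧸ Q) ≤ ringKrullDim (R ⧸ Ideal.span {q}))) ∧
      IsRegularLocalRing (R ⧸ Ideal.span {q}) ∧
      ∃ G : R, (⟨s ^ p, hs⟩ : R) - G ^ p ∈ Ideal.span {q} ^ p := by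
  classical
  have hp : p.Prime := Fact.out
  haveI : IsDomain R := inferInstance
  set f : R := ⟨s ^ p, hs⟩ with hfdef
  set P : Ideal R := Ideal.span {q} with hPdef
  have hq0 : q ≠ 0 := hq.ne_zero
  have hqm : q ∈ maximalIdeal R := (IsLocalRing.mem_maximalIdeal _).mpr hq.not_unit
  haveI hPprime : P.IsPrime := (Ideal.span_singleton_prime hq0).mpr hq
  haveI : IsRegularLocalRing (R ⧸ P) := hregq
  -- dimensions: `dim R/(q) + 1 = dim R = n`
  obtain ⟨m, hm⟩ := exists_nat_cast_eq_ringKrullDim (R := R ⧸ P)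
  have hmn : m + 1 = n := by
    have h := ringKrullDim_quotient_span_singleton_succ_eq_ringKrullDim_of_mem_nonZeroDivisors
      (mem_nonZeroDivisors_of_ne_zero hq0) hqm
    rw [← hPdef, hm, hdim] at h
    exact_mod_cast h
  -- `(q) ≠ 𝔪_R`
  have hPne : P ≠ maximalIdeal R := by
    intro hP
    haveI : P.IsMaximal := hP ▸ IsLocalRing.maximalIdeal.isMaximal R
    have hfield : IsField (R ⧸ P) := (Ideal.Quotient.maximal_ideal_iff_isField_quotient P).mp ‹_›
    have h0 : ringKrullDim (R ⧸ P) = 0 := by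
      letI := hfield.toField
      exact ringKrullDim_eq_zero_of_isField hfield
    rw [hm] at h0
    have : m = 0 := by exact_mod_cast h0
    omega
  -- the cleaning lies in `(q)²` as well (`p ≥ 2`)
  obtain ⟨G, hG⟩ := hclean
  have hclean2 : f - G ^ p ∈ P ^ 2 := Ideal.pow_le_pow_right hp.two_le hG
  -- singular at `(q)`
  have hsing : ¬ IsRegularLocalRing (AdjoinRoot (Polynomial.X ^ p - Polynomial.C
      (algebraMap R (Localization.AtPrime P) f))) :=
    AutoPermissible.singular_atPrime_of_sub_pow_mem_sq K p R f P hclean2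
  -- `⊥` is not singular
  have hbot : IsRegularLocalRing (AdjoinRoot (Polynomial.X ^ p - Polynomial.C
      (algebraMap R (Localization.AtPrime (⊥ : Ideal R)) f))) :=
    DivisorTrigger.isRegularLocalRing_adjoinRoot_bot p R f s rfl hirr
  refine ⟨hPne, ⟨hPprime, hsing, ?_, ?_⟩, hregq, G, hG⟩
  · -- minimality among singular primes
    intro Q _ hQsing hQP
    by_contra hne
    have hQ0 : Q = ⊥ := DivisorTrigger.eq_bot_of_lt_span_singleton hqm hQP hne
    subst hQ0
    exact hQsing hbot
  · -- top-dimensionality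
    intro Q hQ hQsing _
    have hQ0 : Q ≠ ⊥ := by
      rintro rfl
      exact hQsing hbot
    haveI : Nontrivial (R ⧸ Q) := Ideal.Quotient.nontrivial_iff.mpr hQ.ne_top
    haveI : IsLocalRing (R ⧸ Q) := .of_surjective' _ Ideal.Quotient.mk_surjective
    obtain ⟨mQ, hmQ⟩ := exists_nat_cast_eq_ringKrullDim (R := R ⧸ Q)
    obtain ⟨c, hc⟩ := ENat.ne_top_iff_exists.mp (Q.height_ne_top hQ.ne_top)
    have hform := height_add_ringKrullDim_quotient (S := R) Q
    rw [hmQ, hdim, ← hc] at hform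
    have hcm : c + mQ = n := by exact_mod_cast hform
    have hc1 : 1 ≤ c := by
      have h1 := Ideal.height_add_one_le_of_lt_of_isPrime (bot_lt_iff_ne_bot.mpr hQ0)
      rw [Ideal.height_bot, ← hc, zero_add] at h1
      exact_mod_cast h1
    rw [hmQ, hm]
    have : mQ ≤ m := by omega
    exact_mod_cast this

/-! ## §2 σ_top takes a divisor first -/

/-- **In a regular local ring, a singular prime of top dimension against a height-one competitor is a principal prime
divisor.** If `P` is a prime `≠ ⊥` of the regular local ring `R` of dimension `n` and `dim R ⧸ (q) ≤ dim R ⧸ P` for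
some prime element `q`, then `P` has height one and `P = (π)` for a prime element `π` (dimension formula; a regular
local ring is a UFD, Auslander–Buchsbaum). OURS (W4.1 engine). [cite: Matsumura1987, Thm. 20.3] -/
theorem exists_prime_span_singleton_eq_of_ringKrullDim_le (R : Subring K) [IsRegularLocalRing R] {n : ℕ}
    (hdim : ringKrullDim R = n) (q : R) (hq : Prime q) (P : Ideal R) [hP : P.IsPrime] (hP0 : P ≠ ⊥)
    (hle : ringKrullDim (R ⧸ Ideal.span {q}) ≤ ringKrullDim (R ⧸ P)) :
    P.height = 1 ∧ ∃ π : R, Prime π ∧ P = Ideal.span {π} := by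
  classical
  haveI : IsDomain R := inferInstance
  have hq0 : q ≠ 0 := hq.ne_zero
  have hqm : q ∈ maximalIdeal R := (IsLocalRing.mem_maximalIdeal _).mpr hq.not_unit
  -- `dim R/(q) + 1 = n`
  haveI : Nontrivial (R ⧸ Ideal.span {q}) :=
    Ideal.Quotient.nontrivial_iff.mpr (Ideal.span_singleton_ne_top hq.not_unit)
  haveI : IsLocalRing (R ⧸ Ideal.span {q}) := .of_surjective' _ Ideal.Quotient.mk_surjective
  obtain ⟨m, hm⟩ := exists_nat_cast_eq_ringKrullDim (R := R ⧸ Ideal.span {q})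
  have hmn : m + 1 = n := by
    have h := ringKrullDim_quotient_span_singleton_succ_eq_ringKrullDim_of_mem_nonZeroDivisors
      (mem_nonZeroDivisors_of_ne_zero hq0) hqm
    rw [hm, hdim] at h
    exact_mod_cast h
  -- `ht P + dim R/P = n` with `ht P ≥ 1`
  haveI : Nontrivial (R ⧸ P) := Ideal.Quotient.nontrivial_iff.mpr hP.ne_top
  haveI : IsLocalRing (R ⧸ P) := .of_surjective' _ Ideal.Quotient.mk_surjective
  obtain ⟨mP, hmP⟩ := exists_nat_cast_eq_ringKrullDim (R := R ⧸ P)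
  obtain ⟨c, hc⟩ := ENat.ne_top_iff_exists.mp (P.height_ne_top hP.ne_top)
  have hform := height_add_ringKrullDim_quotient (S := R) P
  rw [hmP, hdim, ← hc] at hform
  have hcm : c + mP = n := by exact_mod_cast hform
  have hc1 : 1 ≤ c := by
    have h1 := Ideal.height_add_one_le_of_lt_of_isPrime (bot_lt_iff_ne_bot.mpr hP0)
    rw [Ideal.height_bot, ← hc, zero_add] at h1
    exact_mod_cast h1
  rw [hm, hmP] at hle
  have hle' : m ≤ mP := by exact_mod_cast hle
  have hc' : c = 1 := by omega
  have hht : P.height = 1 := by rw [← hc, hc']; rfl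
  refine ⟨hht, ?_⟩
  haveI : UniqueFactorizationMonoid R := uniqueFactorizationMonoid_of_isRegularLocalRing R ‹_›
  obtain ⟨π, hπP, hπ⟩ := hP.exists_mem_prime_of_ne_bot hP0
  exact ⟨π, hπ, Ideal.eq_span_singleton_of_height_eq_one hht hπP hπ⟩

/-- **σ_top takes a divisor FIRST** (RULING 7 (N4), the divisor-priority step). Let `R ⊆ K` be a regular local
subring of dimension `n ≥ 2`, `char K = p`, `f = s ^ p ∈ R` with field generic torsor fibre, and `P` the σ_top centre
of `(R, f)` (body of `IsSigmaTopCentre R p f P`). If SOME regular prime carrier exists — `q ∈ R` prime, `R ⧸ (q)`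
regular, `f − G ^ p ∈ (q) ^ p` — then the point step is excluded and `P` is a principal prime divisor: `P ≠ 𝔪_R`,
`ht P = 1`, `P = (π)` with `π` prime. (`(q)` is permissible of dimension `n − 1`, and a permissible `P` dominates
every minimal singular prime in dimension.) OURS (W4.1 engine). [cite: Matsumura1987, Thm. 20.3] -/
theorem height_eq_one_of_sigmaTop_of_prime_carrier (p : ℕ) [Fact p.Prime] [CharP K p] (R : Subring K)
    [IsRegularLocalRing R] {n : ℕ} (hdim : ringKrullDim R = n) (hn : 2 ≤ n)
    {s : K} (hs : s ^ p ∈ R) (hirr : ∀ y z : R, (z : K) ≠ 0 → s * z ≠ y)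
    (q : R) (hq : Prime q) (hregq : IsRegularLocalRing (R ⧸ Ideal.span {q}))
    (hclean : ∃ G : R, (⟨s ^ p, hs⟩ : R) - G ^ p ∈ Ideal.span {q} ^ p)
    (P : Ideal R)
    (hσ : (P ≠ maximalIdeal R ∧
        (∃ _ : P.IsPrime,
          ¬ IsRegularLocalRing (AdjoinRoot (Polynomial.X ^ p - Polynomial.C
              (algebraMap R (Localization.AtPrime P) ⟨s ^ p, hs⟩))) ∧
          (∀ (Q : Ideal R) [Q.IsPrime],
            ¬ IsRegularLocalRing (AdjoinRoot (Polynomial.X ^ p - Polynomial.C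
                (algebraMap R (Localization.AtPrime Q) ⟨s ^ p, hs⟩))) →
              Q ≤ P → Q = P) ∧
          (∀ (Q : Ideal R) [Q.IsPrime],
            ¬ IsRegularLocalRing (AdjoinRoot (Polynomial.X ^ p - Polynomial.C
                (algebraMap R (Localization.AtPrime Q) ⟨s ^ p, hs⟩))) →
              (∀ (Q' : Ideal R) [Q'.IsPrime],
                ¬ IsRegularLocalRing (AdjoinRoot (Polynomial.X ^ p - Polynomial.C
                    (algebraMap R (Localization.AtPrime Q') ⟨s ^ p, hs⟩))) →
                  Q' ≤ Q → Q' = Q) →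
              ringKrullDim (R ⧸ Q) ≤ ringKrullDim (R ⧸ P))) ∧
        IsRegularLocalRing (R ⧸ P) ∧ ∃ g : R, (⟨s ^ p, hs⟩ : R) - g ^ p ∈ P ^ p) ∨
      (P = maximalIdeal R ∧
        (∀ Q : Ideal R, ¬ (Q ≠ maximalIdeal R ∧
          (∃ _ : Q.IsPrime,
            ¬ IsRegularLocalRing (AdjoinRoot (Polynomial.X ^ p - Polynomial.C
                (algebraMap R (Localization.AtPrime Q) ⟨s ^ p, hs⟩))) ∧
            (∀ (Q₁ : Ideal R) [Q₁.IsPrime],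
              ¬ IsRegularLocalRing (AdjoinRoot (Polynomial.X ^ p - Polynomial.C
                  (algebraMap R (Localization.AtPrime Q₁) ⟨s ^ p, hs⟩))) →
                Q₁ ≤ Q → Q₁ = Q) ∧
            (∀ (Q₁ : Ideal R) [Q₁.IsPrime],
              ¬ IsRegularLocalRing (AdjoinRoot (Polynomial.X ^ p - Polynomial.C
                  (algebraMap R (Localization.AtPrime Q₁) ⟨s ^ p, hs⟩))) →
                (∀ (Q' : Ideal R) [Q'.IsPrime],
                  ¬ IsRegularLocalRing (AdjoinRoot (Polynomial.X ^ p - Polynomial.C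
                      (algebraMap R (Localization.AtPrime Q') ⟨s ^ p, hs⟩))) →
                    Q' ≤ Q₁ → Q' = Q₁) →
                ringKrullDim (R ⧸ Q₁) ≤ ringKrullDim (R ⧸ Q))) ∧
          IsRegularLocalRing (R ⧸ Q) ∧ ∃ g : R, (⟨s ^ p, hs⟩ : R) - g ^ p ∈ Q ^ p)) ∧
        ∃ g : R, (⟨s ^ p, hs⟩ : R) - g ^ p ∈ maximalIdeal R ^ p)) :
    P ≠ maximalIdeal R ∧ P.height = 1 ∧ ∃ π : R, Prime π ∧ P = Ideal.span {π} := by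
  classical
  haveI : IsDomain R := inferInstance
  have hperm := isPermissibleCentre_of_prime_carrier p R hdim hn hs hirr q hq hregq hclean
  rcases hσ with ⟨hPne, ⟨hPprime, hPsing, hPmin, hPtop⟩, -, -⟩ | ⟨-, hnone, -⟩
  · -- a permissible `P` dominates the minimal singular prime `(q)` in dimension
    obtain ⟨-, ⟨_, hqsing, hqmin, -⟩, -, -⟩ := hperm
    have hle : ringKrullDim (R ⧸ Ideal.span {q}) ≤ ringKrullDim (R ⧸ P) :=
      hPtop (Ideal.span {q}) hqsing (fun Q' _ hQ' hQ'q => hqmin Q' hQ' hQ'q)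
    have hP0 : P ≠ ⊥ := by
      rintro rfl
      exact hPsing (DivisorTrigger.isRegularLocalRing_adjoinRoot_bot p R ⟨s ^ p, hs⟩ s rfl hirr)
    exact ⟨hPne, exists_prime_span_singleton_eq_of_ringKrullDim_le R hdim q hq P hP0 hle⟩
  · exact absurd hperm (hnone (Ideal.span {q}))

/-! ## §3 The carrier dichotomy at one stage -/

/-- **A carrier with `h = 0` is impossible**: `s ^ p = g ^ p` with `g ∈ R` forces `s = g ∈ R` in characteristic `p`,
against the field generic fibre. OURS. [folklore] -/
theorem carrier_ne_zero (p : ℕ) [Fact p.Prime] [CharP K p] (R : Subring K)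
    {s : K} (hirr : ∀ y z : R, (z : K) ≠ 0 → s * z ≠ y) {g h u : K} (hg : g ∈ R)
    (heq : s ^ p = g ^ p + h ^ p * u) : h ≠ 0 := by
  rintro rfl
  have hp : p.Prime := Fact.out
  rw [zero_pow hp.ne_zero, zero_mul, add_zero] at heq
  have hsg : s = g := by
    have h0 : (s - g) ^ p = 0 := by rw [sub_pow_char (R := K) s g, heq, sub_self]
    exact sub_eq_zero.mp (pow_eq_zero_iff hp.ne_zero |>.mp h0)
  exact hirr ⟨g, hg⟩ 1 (by simp) (by rw [hsg]; simp)

/-- **The carrier dichotomy** (RULING 7 (N4), one stage). Let `R ⊆ K` be a regular local subring of dimension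
`n ≥ 2` dominated by the valuation ring `O` (`a ∈ 𝔪_R ↔ v(a) < 1`), `char K = p`, `f = s ^ p ∈ R` with field generic
torsor fibre, `P` the σ_top centre of `(R, f)` (body of `IsSigmaTopCentre`), and assume the body of strat-2's
`NoSingularCarrier O R p s` (every prime factor of a carrier has regular quotient). Then EITHER the body of
`NormalAt O R p s` holds (no carrier of positive value at all) OR the σ_top centre is a principal prime divisor:
`P ≠ 𝔪_R`, `ht P = 1`, `P = (π)`, `π` prime. (A carrier `(g, h, u)` with `v(h) < 1` has `h ≠ 0`, so `h` has a prime
factor `q`, regular by `NoSingularCarrier`, and `f − g ^ p = q ^ p · ((h/q) ^ p u)`: a regular prime carrier, so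
§2 applies.) OURS (W4.1 engine). [cite: Matsumura1987, Thm. 20.3] -/
theorem normalAt_or_divisorCentre_of_noSingularCarrier (p : ℕ) [Fact p.Prime] [CharP K p]
    (O : ValuationSubring K) (R : Subring K) [IsRegularLocalRing R] {n : ℕ} (hdim : ringKrullDim R = n)
    (hn : 2 ≤ n) (hval : ∀ a : R, a ∈ maximalIdeal R ↔ O.valuation (a : K) < 1)
    {s : K} (hs : s ^ p ∈ R) (hirr : ∀ y z : R, (z : K) ≠ 0 → s * z ≠ y)
    (hNSC : ∀ g h u : K, g ∈ R → ∀ hh : h ∈ R, u ∈ R → s ^ p = g ^ p + h ^ p * u →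
      ∀ q : R, Prime q → q ∣ (⟨h, hh⟩ : R) → IsRegularLocalRing (R ⧸ Ideal.span {q}))
    (P : Ideal R)
    (hσ : (P ≠ maximalIdeal R ∧
        (∃ _ : P.IsPrime,
          ¬ IsRegularLocalRing (AdjoinRoot (Polynomial.X ^ p - Polynomial.C
              (algebraMap R (Localization.AtPrime P) ⟨s ^ p, hs⟩))) ∧
          (∀ (Q : Ideal R) [Q.IsPrime],
            ¬ IsRegularLocalRing (AdjoinRoot (Polynomial.X ^ p - Polynomial.C
                (algebraMap R (Localization.AtPrime Q) ⟨s ^ p, hs⟩))) →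
              Q ≤ P → Q = P) ∧
          (∀ (Q : Ideal R) [Q.IsPrime],
            ¬ IsRegularLocalRing (AdjoinRoot (Polynomial.X ^ p - Polynomial.C
                (algebraMap R (Localization.AtPrime Q) ⟨s ^ p, hs⟩))) →
              (∀ (Q' : Ideal R) [Q'.IsPrime],
                ¬ IsRegularLocalRing (AdjoinRoot (Polynomial.X ^ p - Polynomial.C
                    (algebraMap R (Localization.AtPrime Q') ⟨s ^ p, hs⟩))) →
                  Q' ≤ Q → Q' = Q) →
              ringKrullDim (R ⧸ Q) ≤ ringKrullDim (R ⧸ P))) ∧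
        IsRegularLocalRing (R ⧸ P) ∧ ∃ g : R, (⟨s ^ p, hs⟩ : R) - g ^ p ∈ P ^ p) ∨
      (P = maximalIdeal R ∧
        (∀ Q : Ideal R, ¬ (Q ≠ maximalIdeal R ∧
          (∃ _ : Q.IsPrime,
            ¬ IsRegularLocalRing (AdjoinRoot (Polynomial.X ^ p - Polynomial.C
                (algebraMap R (Localization.AtPrime Q) ⟨s ^ p, hs⟩))) ∧
            (∀ (Q₁ : Ideal R) [Q₁.IsPrime],
              ¬ IsRegularLocalRing (AdjoinRoot (Polynomial.X ^ p - Polynomial.C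
                  (algebraMap R (Localization.AtPrime Q₁) ⟨s ^ p, hs⟩))) →
                Q₁ ≤ Q → Q₁ = Q) ∧
            (∀ (Q₁ : Ideal R) [Q₁.IsPrime],
              ¬ IsRegularLocalRing (AdjoinRoot (Polynomial.X ^ p - Polynomial.C
                  (algebraMap R (Localization.AtPrime Q₁) ⟨s ^ p, hs⟩))) →
                (∀ (Q' : Ideal R) [Q'.IsPrime],
                  ¬ IsRegularLocalRing (AdjoinRoot (Polynomial.X ^ p - Polynomial.C
                      (algebraMap R (Localization.AtPrime Q') ⟨s ^ p, hs⟩))) →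
                    Q' ≤ Q₁ → Q' = Q₁) →
                ringKrullDim (R ⧸ Q₁) ≤ ringKrullDim (R ⧸ Q))) ∧
          IsRegularLocalRing (R ⧸ Q) ∧ ∃ g : R, (⟨s ^ p, hs⟩ : R) - g ^ p ∈ Q ^ p)) ∧
        ∃ g : R, (⟨s ^ p, hs⟩ : R) - g ^ p ∈ maximalIdeal R ^ p)) :
    (∀ g h u : K, g ∈ R → h ∈ R → u ∈ R → O.valuation h < 1 → s ^ p ≠ g ^ p + h ^ p * u) ∨
      (P ≠ maximalIdeal R ∧ P.height = 1 ∧ ∃ π : R, Prime π ∧ P = Ideal.span {π}) := by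
  classical
  haveI : IsDomain R := inferInstance
  by_cases hN : ∀ g h u : K, g ∈ R → h ∈ R → u ∈ R → O.valuation h < 1 → s ^ p ≠ g ^ p + h ^ p * u
  · exact Or.inl hN
  right
  push Not at hN
  obtain ⟨g, h, u, hg, hh, hu, hvh, heq⟩ := hN
  -- the carrier `h ≠ 0` is a non-unit, so it has a prime factor `q`, regular by `NoSingularCarrier`
  have hh0 : h ≠ 0 := carrier_ne_zero p R hirr hg heq
  set hR : R := ⟨h, hh⟩ with hhRdef
  have hhR0 : hR ≠ 0 := fun e => hh0 (congrArg Subtype.val e)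
  have hhRm : hR ∈ maximalIdeal R := (hval hR).mpr hvh
  have hhRu : ¬ IsUnit hR := (IsLocalRing.mem_maximalIdeal _).mp hhRm
  haveI : UniqueFactorizationMonoid R := uniqueFactorizationMonoid_of_isRegularLocalRing R ‹_›
  obtain ⟨q, hqirr, hqh⟩ := WfDvdMonoid.exists_irreducible_factor hhRu hhR0
  have hq : Prime q := UniqueFactorizationMonoid.irreducible_iff_prime.mp hqirr
  have hregq : IsRegularLocalRing (R ⧸ Ideal.span {q}) := hNSC g h u hg hh hu heq q hq hqh
  -- the cleaning `f − g^p = q^p · ((h/q)^p u) ∈ (q)^p`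
  obtain ⟨w, hw⟩ := hqh
  have hclean : ∃ G : R, (⟨s ^ p, hs⟩ : R) - G ^ p ∈ Ideal.span {q} ^ p := by
    refine ⟨⟨g, hg⟩, ?_⟩
    rw [Ideal.span_singleton_pow, Ideal.mem_span_singleton']
    refine ⟨w ^ p * ⟨u, hu⟩, Subtype.ext ?_⟩
    have hwK : (h : K) = (q : K) * (w : K) := by
      have e := congrArg Subtype.val hw
      simpa [hhRdef, Subring.coe_mul] using e
    simp only [Subring.coe_mul, Subring.coe_pow, AddSubgroupClass.coe_sub]
    rw [heq, hwK]
    ring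
  exact height_eq_one_of_sigmaTop_of_prime_carrier p R hdim hn hs hirr q hq hregq hclean P hσ

end Summit.ResolutionOfSingularities.ResolutionOfSingularities.Theorems.SwitchingDichotomy.NoSingularCarrier

end
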